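import Summits.NavierStokesRegularity.FunctionalMining.NoGo.TopBotEigHeatCoerciveTwo
import Summits.NavierStokesRegularity.FunctionalMining.TopEigGapCutoffPowDeriv
import HarnessLib

/-!
# FunctionalMining / NoGo — K15: a certified top gap floors the top strain eigenvalue
# (`(2/3)(λ₁ − λ₂) ≤ λ₁`), so the weight `λ₁^{q−2}` of the low moments `1 < q < 2` is bounded on every
# gap-certified region — the one new ingredient of door D-K6 (b) below `q = 2`

v2 = K15′ (no-go seat gen 43, LEAD RULING (ιι)(iii) after the gate bounce of p367550 `dedup.landed`): the v1 theorem `topEig_pos_of_midEig_lt` is REMOVED — it restated the tree's `TopEig.topEig_pos_of_simple` (`FunctionalMining/TopEigGapCutoffPowDeriv`, prove g26), which is now imported and used at the one call site in `gap_floor_summary`; and the file is NOTATION-FREE (v1's local abbreviation `𝕍₃` is expanded to `UnitAddTorus (Fin 3) → EuclideanSpace ℝ (Fin 3)` everywhere; K7/K10 v2 precedent). All other declarations are byte-identical to v1 58ffb6a023cdefc3 (= the prove seat's pre-filing copy d0acd922b8a28774 minus its FILING line, census-1 (cc.204)).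

HONEST FRAMING. Search for candidate a priori estimates; no regularity claim. Nothing about Navier–Stokes is
proved or asserted in this file: pointwise linear algebra of the three sorted eigenvalues `λ₁ ≥ λ₂ ≥ λ₃`,
`λ₁ + λ₂ + λ₃ = 0`, of the strain of a smooth divergence-free field on `T³`, and its consequence for real
powers `λ₁^{q−2}` with `q ≤ 2`. Cell `pub-nsfunc`, no-go seat (gen 42), kernel candidate K15 (one file).

THE TARGET. Door D-K6 (b) of `NOGO.md` §3 (low moments `Φ_q = ∫(λ₁⁺)^q`, `3/2 < q < 2`; the one-sided heat
node `TopEigHeatCoercivePos q` = Lemma L-λ(q), OPEN in the kernel for every `q`, FAILS ON PAPER for `q ≥ 2`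
along the (F1) family — pen THEOREM A / COROLLARY A of the seat's `sieveld/x2c/F1-PART2-A-NOTE.md`). The pen
proof for `q ≥ 2` evaluates the channel density `F_q(S) = q(q−1)λ₁^{q−2}|∇λ₁|² + 2qλ₁^{q−1}Σ⟨Rw,w⟩` ONLY on
regions where the top eigenvalue is simple with a CERTIFIED gap `λ₁ − λ₂ ≥ γ > 0`, and bounds `λ₁^{q−2}` there
from ABOVE by `Λ^{q−2}` (`λ₁ ≤ Λ`), which is where `q ≥ 2` enters (its REMARK A4 (q)). For `q < 2` the exponent
`q − 2` is negative and one needs `λ₁` bounded BELOW on the same regions. This file supplies exactly that, by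
name, over the tree's densities `torusStrainTopEig` / `torusStrainMidEig`:

* `TopEig.torusStrainMidEig_eq_eig3` — `λ₂ = eig3 · 1` (bookkeeping, companion of the tree's
  `torusStrainTopEig_eq_eig3` / `torusStrainBotEig_eq_eig3` of K6 `NoGo/TopBotEigHeatCoerciveTwo`);
* **`TopEig.two_thirds_gap_le_topEig`** — `(2/3)·(λ₁(x) − λ₂(x)) ≤ λ₁(x)` at every point of a smooth
  divergence-free field (`λ₃ = −λ₁ − λ₂ ≤ λ₂` forces `λ₂ ≥ −λ₁/2`); `TopEig.third_spread_le_topEig` —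
  `(λ₁ − λ₃)/3 ≤ λ₁`; the tree's `TopEig.topEig_pos_of_simple` (`TopEigGapCutoffPowDeriv`, prove g26) — a SIMPLE top (`λ₂ < λ₁`) forces `0 < λ₁`
  (so `λ₁^{q−2}` is finite on the whole simple region `U_s`, every real `q`);
* **`TopEig.topEig_rpow_le_of_gap`** — for `q ≤ 2`, `0 < γ ≤ λ₁(x) − λ₂(x)`:
  `λ₁(x)^{q−2} ≤ ((2/3)γ)^{q−2}`; and **`TopEig.gradChannel_le_of_gap`** — the grad-`λ` channel of the
  kernel density of `TopEig.heatDissipation_topEigMoment_eq_integral_of_midEig_lt` (tree, `TopEigSimpleGap`),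
  `q(q−1)λ₁^{q−2}Σₖ(∂ₖλ₁)²`, is at most `q(q−1)((2/3)γ)^{q−2}Σₖ(∂ₖλ₁)²` there (`1 ≤ q ≤ 2`).

USE (pen, one party; `sieveld/x2c/DOOR-B-LT-TWO-NOTE.md` of this touch). With these floors every `Λ^{q−2}`
factor of the (F1) bookkeeping (PART I LEMMA 6 (ii) and LEMMA 6′ tube constants, NOTE WC STEP 4, NOTE JC
§5.3 (c) `Ξ_k`, COROLLARY UB-2) is replaced by `max(Λ^{q−2}, ((2/3)γ)^{q−2})` with the gap `γ` that the same
line of the proof already certifies, and THEOREM A / COROLLARY A extend verbatim to every real `q > 1`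
(THEOREM A♭: `¬ TopEigHeatCoercivePos q` on paper for all `q > 1`; door (b) CLOSED ON PAPER, one party,
countersigns requested). Nothing of that pen statement is claimed in the kernel here.

NOT CLAIMED. No statement about `heatDissipation`, `TopEigHeatCoercivePos`, the (F1) family or any `𝒦₀` row;
no count, no window, no numerics. References: tree `StrainEigen` (`torusStrainEig`, `torusStrainMidEig`,
`sum_torusStrainEig_eq_zero`), K6 `NoGo/TopBotEigHeatCoerciveTwo` (`TopEig.eig3`, `eig3_antitone`,
`eig3_sum_eq_zero`, `torusStrainTopEig_eq_eig3`, `torusStrainBotEig_eq_eig3`); Mathlib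
`Real.rpow_le_rpow_of_nonpos`. [ours, bookkeeping]
FILING (prove seat g26, REQUEST #30′ (K15′ v2: nogo g43 touch 5, HOME INBOX l.4697, restaged per LEAD RULING (ιι)(iii) after the gate bounced p367550 `dedup.landed`; RULING (κκ)(i): supersedes my queued hand-fixed re-file p367573 of v1)): declarations byte-identical to the no-go seat's staged `TopEigGapFloor.STAGING.lean` 7367ba0ede26ccf9; this line is the only addition.
-/

open Finset

noncomputable section

namespace Summit.NavierStokesRegularity.FunctionalMining

open Literature.Analysis.FunctionSpaces

namespace TopEig

variable {v : UnitAddTorus (Fin 3) → EuclideanSpace ℝ (Fin 3)}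

/-! ## 1. `λ₂ = eig3 · 1` -/

/-- `∑ₖ λₖ = λ₁ + λ₂ + λ₃` written with `eig3`. [bookkeeping] -/
theorem sum_torusStrainEig_eq_eig3 (v : UnitAddTorus (Fin 3) → EuclideanSpace ℝ (Fin 3))
    (x : UnitAddTorus (Fin 3)) :
    ∑ k, torusStrainEig v x k = eig3 v x 0 + eig3 v x 1 + eig3 v x 2 := by
  rw [← Equiv.sum_comp (finCongr (Fintype.card_fin 3).symm) (torusStrainEig v x), Fin.sum_univ_three]
  rfl

/-- **`λ₂ = eig3 · 1`**: the dictionary's middle eigenvalue density `torusStrainMidEig := ∑λₖ − λ₁ − λ₃` is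
the middle sorted eigenvalue (no divergence-free hypothesis needed). [bookkeeping] -/
theorem torusStrainMidEig_eq_eig3 (v : UnitAddTorus (Fin 3) → EuclideanSpace ℝ (Fin 3))
    (x : UnitAddTorus (Fin 3)) :
    torusStrainMidEig v x = eig3 v x 1 := by
  unfold torusStrainMidEig
  rw [sum_torusStrainEig_eq_eig3, torusStrainTopEig_eq_eig3, torusStrainBotEig_eq_eig3]
  ring

/-- `λ₂ ≤ λ₁` pointwise. [folklore] -/
theorem torusStrainMidEig_le_topEig (v : UnitAddTorus (Fin 3) → EuclideanSpace ℝ (Fin 3))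
    (x : UnitAddTorus (Fin 3)) :
    torusStrainMidEig v x ≤ torusStrainTopEig v x := by
  rw [torusStrainMidEig_eq_eig3, torusStrainTopEig_eq_eig3]
  exact eig3_antitone v x (show (0 : Fin 3) ≤ 1 by decide)

/-- `λ₃ ≤ λ₂` pointwise. [folklore] -/
theorem torusStrainBotEig_le_midEig (v : UnitAddTorus (Fin 3) → EuclideanSpace ℝ (Fin 3))
    (x : UnitAddTorus (Fin 3)) :
    torusStrainBotEig v x ≤ torusStrainMidEig v x := by
  rw [torusStrainMidEig_eq_eig3, torusStrainBotEig_eq_eig3]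
  exact eig3_antitone v x (show (1 : Fin 3) ≤ 2 by decide)

/-- `λ₁ + λ₂ + λ₃ = 0` in the dictionary's densities, for smooth divergence-free fields. [folklore] -/
theorem topEig_add_midEig_add_botEig (hv : Torus.IsSmooth v) (hdiv : Torus.IsDivFree v)
    (x : UnitAddTorus (Fin 3)) :
    torusStrainTopEig v x + torusStrainMidEig v x + torusStrainBotEig v x = 0 := by
  rw [torusStrainMidEig_eq_eig3, torusStrainTopEig_eq_eig3, torusStrainBotEig_eq_eig3]
  exact eig3_sum_eq_zero hv hdiv x

/-! ## 2. The gap floors the top eigenvalue -/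

/-- **LEMMA Λ: `(2/3)·(λ₁ − λ₂) ≤ λ₁`** at every point of a smooth divergence-free field on `T³`
(`λ₃ = −λ₁ − λ₂` and `λ₃ ≤ λ₂` give `λ₂ ≥ −λ₁/2`, i.e. `λ₁ − λ₂ ≤ (3/2)λ₁`). Equality on the axisymmetric
stratum `(λ, −λ/2, −λ/2)`. [ours, bookkeeping] -/
theorem two_thirds_gap_le_topEig (hv : Torus.IsSmooth v) (hdiv : Torus.IsDivFree v)
    (x : UnitAddTorus (Fin 3)) :
    2 / 3 * (torusStrainTopEig v x - torusStrainMidEig v x) ≤ torusStrainTopEig v x := by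
  have h12 := torusStrainBotEig_le_midEig v x
  have hs := topEig_add_midEig_add_botEig hv hdiv x
  linarith

/-- **`(λ₁ − λ₃)/3 ≤ λ₁`** (the full spread floors the top as well: `λ₁ − λ₃ = 2λ₁ + λ₂ ≤ 3λ₁`).
[ours, bookkeeping] -/
theorem third_spread_le_topEig (hv : Torus.IsSmooth v) (hdiv : Torus.IsDivFree v)
    (x : UnitAddTorus (Fin 3)) :
    (torusStrainTopEig v x - torusStrainBotEig v x) / 3 ≤ torusStrainTopEig v x := by
  have h01 := torusStrainMidEig_le_topEig v x
  have hs := topEig_add_midEig_add_botEig hv hdiv x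
  linarith

/-- A certified gap `γ ≤ λ₁ − λ₂` floors the top: `(2/3)γ ≤ λ₁(x)`. [ours, bookkeeping] -/
theorem two_thirds_le_topEig_of_gap (hv : Torus.IsSmooth v) (hdiv : Torus.IsDivFree v)
    {x : UnitAddTorus (Fin 3)} {γ : ℝ} (hgap : γ ≤ torusStrainTopEig v x - torusStrainMidEig v x) :
    2 / 3 * γ ≤ torusStrainTopEig v x :=
  le_trans (by linarith) (two_thirds_gap_le_topEig hv hdiv x)

/-! ## 3. The weight `λ₁^{q−2}` for `q ≤ 2` on a gap-certified region -/

/-- **`λ₁(x)^{q−2} ≤ ((2/3)γ)^{q−2}`** for `q ≤ 2` wherever the top gap is certified, `0 < γ ≤ λ₁(x) − λ₂(x)`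
(the exponent is `≤ 0`, the base is floored by `(2/3)γ > 0`). For `q ≥ 2` the (F1) notes use the ceiling
`λ₁^{q−2} ≤ Λ^{q−2}` instead; this is its mirror below `q = 2`. [ours, bookkeeping] -/
theorem topEig_rpow_le_of_gap {q γ : ℝ} (hq : q ≤ 2) (hγ : 0 < γ) (hv : Torus.IsSmooth v)
    (hdiv : Torus.IsDivFree v) {x : UnitAddTorus (Fin 3)}
    (hgap : γ ≤ torusStrainTopEig v x - torusStrainMidEig v x) :
    torusStrainTopEig v x ^ (q - 2) ≤ (2 / 3 * γ) ^ (q - 2) :=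
  Real.rpow_le_rpow_of_nonpos (by positivity) (two_thirds_le_topEig_of_gap hv hdiv hgap) (by linarith)

/-- **The grad-`λ` channel below `q = 2` on a gap-certified region.** The first summand of the kernel density
of `TopEig.heatDissipation_topEigMoment_eq_integral_of_midEig_lt` (`TopEigSimpleGap`),
`q(q−1)·λ₁^{q−2}·Σₖ(∂ₖλ₁)²`, is at most `q(q−1)·((2/3)γ)^{q−2}·Σₖ(∂ₖλ₁)²` at every point with
`0 < γ ≤ λ₁ − λ₂`, for `1 ≤ q ≤ 2` — PART I LEMMA 6 (ii)'s majorant with the floor in place of the ceiling.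
[ours, bookkeeping] -/
theorem gradChannel_le_of_gap {q γ : ℝ} (hq1 : 1 ≤ q) (hq : q ≤ 2) (hγ : 0 < γ) (hv : Torus.IsSmooth v)
    (hdiv : Torus.IsDivFree v) {x : UnitAddTorus (Fin 3)}
    (hgap : γ ≤ torusStrainTopEig v x - torusStrainMidEig v x) :
    q * (q - 1) * torusStrainTopEig v x ^ (q - 2) *
        ∑ k, Torus.partialDeriv k (torusStrainTopEig v) x ^ 2 ≤
      q * (q - 1) * (2 / 3 * γ) ^ (q - 2) * ∑ k, Torus.partialDeriv k (torusStrainTopEig v) x ^ 2 := by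
  have hpow := topEig_rpow_le_of_gap hq hγ hv hdiv hgap
  have hqq : 0 ≤ q * (q - 1) := mul_nonneg (by linarith) (by linarith)
  have hsum : 0 ≤ ∑ k, Torus.partialDeriv k (torusStrainTopEig v) x ^ 2 :=
    Finset.sum_nonneg fun k _ => sq_nonneg _
  exact mul_le_mul_of_nonneg_right (mul_le_mul_of_nonneg_left hpow hqq) hsum

/-- **Summary (door D-K6 (b), kernel side of the ♭-bookkeeping).** On a smooth divergence-free field: the top
is floored by two thirds of the top gap and by a third of the spread, a simple top is positive, and below
`q = 2` the weight `λ₁^{q−2}` is bounded on every gap-certified region by `((2/3)γ)^{q−2}`. [ours] -/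
theorem gap_floor_summary (hv : Torus.IsSmooth v) (hdiv : Torus.IsDivFree v) :
    (∀ x, 2 / 3 * (torusStrainTopEig v x - torusStrainMidEig v x) ≤ torusStrainTopEig v x) ∧
    (∀ x, (torusStrainTopEig v x - torusStrainBotEig v x) / 3 ≤ torusStrainTopEig v x) ∧
    (∀ x, torusStrainMidEig v x < torusStrainTopEig v x → 0 < torusStrainTopEig v x) ∧
    (∀ q γ : ℝ, q ≤ 2 → 0 < γ → ∀ x, γ ≤ torusStrainTopEig v x - torusStrainMidEig v x →
      torusStrainTopEig v x ^ (q - 2) ≤ (2 / 3 * γ) ^ (q - 2)) :=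
  ⟨two_thirds_gap_le_topEig hv hdiv, third_spread_le_topEig hv hdiv,
    fun _ hx => topEig_pos_of_simple hv hdiv hx,
    fun _ _ hq hγ _ hgap => topEig_rpow_le_of_gap hq hγ hv hdiv hgap⟩

end TopEig

end Summit.NavierStokesRegularity.FunctionalMining
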